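import Summits.QuantumFields.QCD.Theorems.QuarksAsStableActionStableActionBridgeSliceKernelInvariance
import Summits.QuantumFields.QCD.Theorems.QuarksAsStableActionStableActionBridgeSliceGaugeUnitarity
import Summits.QuantumFields.QCD.Theorems.QuarksAsStableActionStableActionBridgeFockLiftPosDef
import Literature.MathematicalPhysics.QuantumFieldTheory.StrongCouplingActivities
import Literature.MathematicalPhysics.QuantumFieldTheory.QCDTimeReflection
import HarnessLib

/-!
# The Gauss-averaged gauge bond kernel is Hermitian
(stub `stub_bondKernel_star` of line `twisted_trace_transfer` for crux
`QuarksAsStableAction.StableActionBridge`, item stmt-QuantumFields-9737, `--supports`; sub-goal B2 of step E3)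

Step E3 of the line realises Lüscher's transfer matrix of lattice QCD as an `L²` integral operator whose kernel
contains the Gauss-averaged Wilson gauge bond kernel
`B(U, U')_{s s'} = ∫ K_β(U, U'^g) Γ(G_g)_{s s'} dg`
(integral over the temporal links `g : sites → SU(3)` against product Haar measure; `K_β = gaugeSliceKernel` is the
real, symmetric, gauge-invariant pure-gauge transfer kernel and `Γ(G_g) = fockGaugeAct g` the unitary action of
`g` on the slice Fock space, both from `Literature/…/QCDTransferMatrix.lean`).  This file proves that `B` is a
Hermitian matrix-valued kernel: `B(U', U)_{s' s} = conj B(U, U')_{s s'}`.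

Proof.  `conj ∫ = ∫ conj` (`integral_conj`); `conj (K · Γ(G_g)_{s s'}) = K · (Γ(G_g)ᴴ)_{s' s}` (`K` is real);
`Γ(G_g)ᴴ = Γ(G_{g⁻¹})` — entrywise `(R_c(g))ᴴ = R_c(g⁻¹)` for the block-diagonal colour rotation with `SU(3)`
blocks (`g(x)⁻¹ = g(x)ᴴ`), transported through `sliceKron`, `reindex` and the `ᴴ`-preserving Fock functor
(`Sketch.SliceNilpotent.sliceKron_conjTranspose`, `Matrix.conjTranspose_reindex`,
`Sketch.FockLiftPosDef.fockLift_conjTranspose`); the product Haar probability measure on the compact group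
`sites → SU(3)` is inversion invariant (`haarProbability.instIsInvInvariant`, `Measure.pi.isInvInvariant`), so
`g ↦ g⁻¹` may be substituted (`integral_inv_eq_self`); finally
`K_β(U, U'^{g⁻¹}) = K_β(U^g, U') = K_β(U', U^g)` by the invariance of the kernel under simultaneous gauge
transformations (`Sketch.gaugeSliceKernel_gaugeTransform`, with the action law `(U'^{g⁻¹})^g = U'`) and its symmetry
(`gaugeSliceKernel_symm`).  Pure theorem file (no definitions); helpers in the sub-namespace `StubBondKernelStar`.

[cite: Luscher1977, pp. 283–292] [cite: Smit2023, §4.6 (4.124)–(4.137)]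
-/

noncomputable section

open MeasureTheory
open scoped InnerProductSpace ComplexConjugate Matrix BigOperators
open Literature.MathematicalPhysics.QuantumFieldTheory Literature.MathematicalPhysics.QuantumLattice
open Literature.Probability.LatticeModels (TorusSite)

namespace Summit.QuantumFields.QCD.Cruxes.StableActionBridge.TwistedTraceTransfer

local notation "𝔾" => Matrix.specialUnitaryGroup (Fin 3) ℂ

namespace StubBondKernelStar

variable {Nf S : ℕ}

/-- The action law of gauge transformations at `g, g⁻¹`: `(U^{g⁻¹})^g = U`. [folklore] -/
theorem gaugeTransform_gaugeTransform_inv {d L : ℕ} {G : Type*} [Group G]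
    (g : Literature.MathematicalPhysics.QuantumFieldTheory.Site d L → G) (U : GaugeConfig d L G) :
    gaugeTransform g (gaugeTransform g⁻¹ U) = U := by
  funext e
  simp [gaugeTransform, mul_assoc]

/-- The spin-blind colour rotation `R_c(g) = (δ_{ff'} δ_{xx'} g(x)_{ab})` satisfies `R_c(g)ᴴ = R_c(g⁻¹)`
(blockwise `g(x)ᴴ = g(x)⁻¹`, `specialUnitary_inv_apply`). [cite: Smit2023, §4.6 (4.124)–(4.126)] -/
theorem colourRot_conjTranspose (g : TorusSite 3 S → 𝔾) :
    (Matrix.of fun p q : SliceColourVar Nf S =>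
        if p.1 = q.1 ∧ p.2.1 = q.2.1 then (g p.2.1 : Matrix (Fin 3) (Fin 3) ℂ) p.2.2 q.2.2 else 0)ᴴ =
      Matrix.of fun p q : SliceColourVar Nf S =>
        if p.1 = q.1 ∧ p.2.1 = q.2.1 then (g⁻¹ p.2.1 : Matrix (Fin 3) (Fin 3) ℂ) p.2.2 q.2.2 else 0 := by
  ext ⟨f, x, a⟩ ⟨f', x', b⟩
  simp only [Matrix.conjTranspose_apply, Matrix.of_apply, Pi.inv_apply, specialUnitary_inv_apply]
  by_cases h : f = f' ∧ x = x'
  · obtain ⟨rfl, rfl⟩ := h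
    simp
  · have h' : ¬ (f' = f ∧ x' = x) := fun hh => h ⟨hh.1.symm, hh.2.symm⟩
    rw [if_neg h', if_neg h, star_zero]

/-- The one-particle gauge rotation of the slice quark modes satisfies `(R_c(g) ⊗ 1)ᴴ = R_c(g⁻¹) ⊗ 1`,
i.e. `(sliceGaugeRot g)ᴴ = sliceGaugeRot g⁻¹`. [cite: Smit2023, §4.6 (4.124)–(4.126)] -/
theorem sliceGaugeRot_conjTranspose (g : TorusSite 3 S → 𝔾) :
    (sliceGaugeRot (Nf := Nf) g)ᴴ = sliceGaugeRot g⁻¹ := by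
  rw [sliceGaugeRot, sliceGaugeRot, Sketch.SliceNilpotent.sliceKron_conjTranspose,
    colourRot_conjTranspose, Matrix.conjTranspose_one]

variable [NeZero S]

/-- **`Γ(G_g)` is a unitary representation at the level of adjoints**: `Γ(G_g)ᴴ = Γ(G_{g⁻¹})`, i.e.
`(fockGaugeAct g)ᴴ = fockGaugeAct g⁻¹` (`Γ = fockLift` and `reindex` commute with `ᴴ`).
[cite: Smit2023, §4.6 (4.125)–(4.127)] -/
theorem fockGaugeAct_conjTranspose (g : TorusSite 3 S → 𝔾) :
    (fockGaugeAct (Nf := Nf) (S := S) g)ᴴ = fockGaugeAct g⁻¹ := by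
  rw [fockGaugeAct, fockGaugeAct, ← Sketch.FockLiftPosDef.fockLift_conjTranspose,
    Matrix.conjTranspose_reindex, sliceGaugeRot_conjTranspose]

/-- Entrywise form of `Γ(G_g)ᴴ = Γ(G_{g⁻¹})`: `conj Γ(G_g)_{s s'} = Γ(G_{g⁻¹})_{s' s}`.
[cite: Smit2023, §4.6 (4.125)–(4.127)] -/
theorem conj_fockGaugeAct_apply (g : TorusSite 3 S → 𝔾)
    (s s' : Finset (SliceFermiIdx Nf S)) :
    (starRingEnd ℂ) (fockGaugeAct (Nf := Nf) (S := S) g s s') = fockGaugeAct g⁻¹ s' s := by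
  rw [← fockGaugeAct_conjTranspose, Matrix.conjTranspose_apply, Complex.star_def]

/-- **Transport of the inverse gauge transformation across the transfer kernel**:
`K_β(U, U'^{g⁻¹}) = K_β(U^g, U') = K_β(U', U^g)` (gauge invariance under the simultaneous transformation
`g`, the action law `(U'^{g⁻¹})^g = U'`, and the symmetry of the kernel).
[cite: Smit2023, §4.6 (4.124)–(4.129)] -/
theorem gaugeSliceKernel_gaugeTransform_inv (β : ℝ) (g : TorusSite 3 S → 𝔾) (U U' : GaugeConfig 3 S 𝔾) :
    gaugeSliceKernel β U (gaugeTransform g⁻¹ U') = gaugeSliceKernel β U' (gaugeTransform g U) := by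
  rw [← Sketch.gaugeSliceKernel_gaugeTransform S β g U (gaugeTransform g⁻¹ U'),
    gaugeTransform_gaugeTransform_inv, gaugeSliceKernel_symm]

end StubBondKernelStar

/-- **Stub `stub_bondKernel_star` of line `twisted_trace_transfer` (sub-goal B2 of E3): the Gauss-averaged
gauge bond kernel is Hermitian.**  With `B(U,U')_{s s'} = ∫ K_β(U, U'^g) Γ(G_g)_{s s'} dg` (product Haar over
the temporal links `g : sites → SU(3)`; `K_β = gaugeSliceKernel`, `Γ(G_g) = fockGaugeAct g`):
`B(U',U)_{s' s} = conj B(U,U')_{s s'}`.  Proof: `conj ∫ = ∫ conj`; `conj Γ(G_g)_{s s'} = Γ(G_{g⁻¹})_{s' s}`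
(unitarity); substitute `g ↦ g⁻¹` (the product Haar probability measure is inversion invariant);
`K_β(U, U'^{g⁻¹}) = K_β(U^g, U') = K_β(U', U^g)` (invariance and symmetry of the kernel).
[cite: Luscher1977, pp. 283–292] [cite: Smit2023, §4.6 (4.127)–(4.137)] -/
theorem stub_bondKernel_star : ∀ (Nf S : ℕ) [NeZero S] (β : ℝ) (U U' : GaugeConfig 3 S 𝔾)
    (s s' : Finset (SliceFermiIdx Nf S)),
    (∫ g : TorusSite 3 S → 𝔾, (gaugeSliceKernel β U' (gaugeTransform g U) : ℂ) * fockGaugeAct (Nf := Nf) g s' s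
        ∂(Measure.pi fun _ => haarProbability 𝔾)) =
      (starRingEnd ℂ) (∫ g : TorusSite 3 S → 𝔾, (gaugeSliceKernel β U (gaugeTransform g U') : ℂ) *
        fockGaugeAct (Nf := Nf) g s s' ∂(Measure.pi fun _ => haarProbability 𝔾)) := by
  intro Nf S _ β U U' s s'
  rw [← integral_conj,
    ← integral_inv_eq_self (fun g : TorusSite 3 S → 𝔾 =>
      (starRingEnd ℂ) ((gaugeSliceKernel β U (gaugeTransform g U') : ℂ) * fockGaugeAct (Nf := Nf) g s s'))]
  refine integral_congr_ae (Filter.Eventually.of_forall fun g => ?_)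
  simp only
  rw [map_mul, Complex.conj_ofReal, StubBondKernelStar.conj_fockGaugeAct_apply, inv_inv,
    StubBondKernelStar.gaugeSliceKernel_gaugeTransform_inv]

end Summit.QuantumFields.QCD.Cruxes.StableActionBridge.TwistedTraceTransfer

end
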